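import Mathlib
import HarnessLib

/-!
# Rung C1 of the crux `EulerZoomLiouville.PowerGaugeEulerLiouville` at the endpoint `ρ = 1/2`:
# the shell flux inequality from the forward profile local energy inequality

Route №10 `EulerZoomLiouville` (NavierStokesRegularity), crux E = stmt-NavierStokesRegularity-19832,
tenure rung C1 (exactly self-similar members) at the endpoint `ρ = 1/2` (`γ = 1/(2+ρ) = 2/5`,
Chae–Shvydkoy `α = 3/2`).  The tree's transfer (`…SelfSimilarLEI`, `…SelfSimilarTransfer`) hands
the profile `(V, P)` of a self-similar member the FORWARD profile local energy inequality

  `(−τ₂)^{5γ−2} ∫ |V|² σ((−τ₂)^γ ·) ≤ (−τ₁)^{5γ−2} ∫ |V|² σ((−τ₁)^γ ·)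
      + ∫_{[τ₁,τ₂)} (−τ)^{6γ−3} ∫ (|V|² + 2P) ⟪V, ∇σ((−τ)^γ ·)⟫ dτ`   (a.e. `τ₁ < τ₂ < 0`).

At the endpoint the energy weights disappear (`5γ − 2 = 0`) and the flux weight is
`(−τ)^{−3/5}`; with `l = (−τ)^{−2/5}` the test `σ((−τ)^γ y) = σ(y/l)` lives at scale `l`.
Choosing a radial bump `σ` (`= 1` on `B_{1/2}`, supported in `B_1`) and GOOD times with
`l₁ ∈ (L/2, L)`, `l₂ ∈ (4L, 8L)` we obtain Chae–Shvydkoy's starting inequality (3.2) in the weak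
class, for EVERY `L > 0`:

* `shell_energy_le_flux_of_profileLEI_half` —
  `∫_{L ≤ |y| < 2L} |V|² ≤ (K/L) ∫_{L/4 ≤ |y| ≤ 8L} (|V|³ + 2|P||V|)`
  with a constant `K` depending only on the bump (the time integral is bounded crudely by
  `(τ₂ − τ₁) sup`, which has the same scaling `L^{−1}` as the exact Fubini computation).

Hypotheses are profile-level and minimal: `|V|², |V|³, |P||V| ∈ L¹_loc` (true for every member
of the class) and the displayed inequality for all smooth compactly supported `σ ≥ 0`.

WHAT THIS IS NOT: not NS, not E, not rung C1 — one inequality of one endpoint stratum.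
-/

noncomputable section

-- flat `Theorems/<Route><Decl>…` files of one crux share the namespace of the crux (tree convention)
set_option linter.dupNamespace false

open MeasureTheory Set Filter Topology Metric Function
open scoped ENNReal NNReal InnerProductSpace RealInnerProductSpace

namespace Summit.NavierStokesRegularity.NavierStokesRegularity.Theorems.PowerGaugeEulerLiouville

section Bump

/-- A smooth function with compact support on `ℝ³` has a bounded gradient. [folklore] -/
theorem exists_norm_gradient_le {σ : EuclideanSpace ℝ (Fin 3) → ℝ} (hσ : ContDiff ℝ (⊤ : ℕ∞) σ)
    (hσc : HasCompactSupport σ) : ∃ K : ℝ, 0 ≤ K ∧ ∀ x, ‖gradient σ x‖ ≤ K := by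
  obtain ⟨C, hC⟩ := (hσc.fderiv ℝ).exists_bound_of_continuous
    (hσ.continuous_fderiv (by simp))
  refine ⟨max C 0, le_max_right _ _, fun x => ?_⟩
  rw [gradient, LinearIsometryEquiv.norm_map]
  exact (hC x).trans (le_max_left _ _)

/-- The gradient of a function vanishes where the function is locally constant. [folklore] -/
theorem gradient_eq_zero_of_eventuallyEq_const {σ : EuclideanSpace ℝ (Fin 3) → ℝ}
    {x : EuclideanSpace ℝ (Fin 3)} {c : ℝ} (h : σ =ᶠ[𝓝 x] fun _ => c) : gradient σ x = 0 := by
  rw [gradient, h.fderiv_eq, fderiv_const_apply, map_zero]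

/-- The standard radial bump of `ℝ³`: `= 1` on `B̄_{1/2}`, supported in `B_1`. [folklore] -/
theorem exists_radialBump :
    ∃ σ : EuclideanSpace ℝ (Fin 3) → ℝ, ContDiff ℝ (⊤ : ℕ∞) σ ∧ HasCompactSupport σ ∧
      (∀ x, 0 ≤ σ x) ∧ (∀ x, σ x ≤ 1) ∧ (∀ x, ‖x‖ ≤ 1 / 2 → σ x = 1) ∧
      (∀ x, 1 ≤ ‖x‖ → σ x = 0) ∧
      (∀ x, gradient σ x ≠ 0 → 1 / 2 ≤ ‖x‖ ∧ ‖x‖ ≤ 1) := by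
  let β : ContDiffBump (0 : EuclideanSpace ℝ (Fin 3)) := ⟨1 / 2, 1, by norm_num, by norm_num⟩
  refine ⟨β, β.contDiff, β.hasCompactSupport, fun x => β.nonneg, fun x => β.le_one,
    fun x hx => β.one_of_mem_closedBall (by rw [mem_closedBall, dist_zero_right]; exact hx),
    fun x hx => β.zero_of_le_dist (by rw [dist_zero_right]; exact hx), fun x hx => ?_⟩
  by_contra hcon
  rw [not_and_or, not_le, not_le] at hcon
  apply hx
  rcases hcon with h | h
  · refine gradient_eq_zero_of_eventuallyEq_const (c := 1) ?_
    exact β.eventuallyEq_one_of_mem_ball (by rw [mem_ball, dist_zero_right]; exact h)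
  · refine gradient_eq_zero_of_eventuallyEq_const (c := 0) ?_
    have hopen : IsOpen {y : EuclideanSpace ℝ (Fin 3) | 1 < ‖y‖} :=
      isOpen_lt continuous_const continuous_norm
    filter_upwards [hopen.mem_nhds h] with y hy
    exact β.zero_of_le_dist (by rw [dist_zero_right]; exact le_of_lt hy)

end Bump

section Flux

/-- Rewriting `(s^{5/2})^{2/5} = s` and friends: `(x ^ a) ^ b = x ^ (a * b)` for `x ≥ 0`.
[folklore] -/
theorem rpow_rpow_eq {x a b : ℝ} (hx : 0 ≤ x) : (x ^ a) ^ b = x ^ (a * b) := by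
  rw [Real.rpow_mul hx]

/-- **Shell flux inequality at the endpoint (Chae–Shvydkoy (3.2) in the weak class).**  Let
`V : ℝ³ → ℝ³`, `P : ℝ³ → ℝ` with `|V|², |V|³, |P||V| ∈ L¹_loc`, and suppose the forward profile
local energy inequality of the class holds at `γ = 2/5` (`ρ = 1/2`) for every smooth compactly
supported `σ ≥ 0` (the hypothesis handed over by `rungC1_of_profileLiouville_full` /
`selfSimilar_profile_energy_le_add_flux`).  Then there is `K ≥ 0` such that for every `L > 0`
`∫_{L ≤ |y| < 2L} |V|² ≤ (K/L) ∫_{L/4 ≤ |y| ≤ 8L} (|V|³ + 2 |P| |V|)`.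
[cite: ChaeShvydkoy2013, §3.1 eq. (3.1)–(3.2)] -/
theorem shell_energy_le_flux_of_profileLEI_half
    {V : EuclideanSpace ℝ (Fin 3) → EuclideanSpace ℝ (Fin 3)} {P : EuclideanSpace ℝ (Fin 3) → ℝ}
    {γ : ℝ} (hγ : γ = 2 / 5)
    (hV2 : LocallyIntegrable (fun y => ‖V y‖ ^ 2) volume)
    (hV3 : LocallyIntegrable (fun y => ‖V y‖ ^ 3) volume)
    (hPV : LocallyIntegrable (fun y => |P y| * ‖V y‖) volume)
    (hLEI : ∀ σ : EuclideanSpace ℝ (Fin 3) → ℝ, ContDiff ℝ (⊤ : ℕ∞) σ → HasCompactSupport σ →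
      (∀ x, 0 ≤ σ x) →
      ∀ᵐ τ₁ : ℝ, τ₁ < 0 → ∀ᵐ τ₂ : ℝ, τ₂ ∈ Ioo τ₁ 0 →
        (-τ₂) ^ (5 * γ - 2) * ∫ y, ‖V y‖ ^ 2 * σ ((-τ₂) ^ γ • y) ≤
          ((-τ₁) ^ (5 * γ - 2) * ∫ y, ‖V y‖ ^ 2 * σ ((-τ₁) ^ γ • y)) +
            ∫ τ in Ico τ₁ τ₂, (-τ) ^ (6 * γ - 3) *
              ∫ y, (‖V y‖ ^ 2 + 2 * P y) * ⟪V y, gradient σ ((-τ) ^ γ • y)⟫) :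
    ∃ K : ℝ, 0 ≤ K ∧ ∀ L : ℝ, 0 < L →
      ∫ y in {y | L ≤ ‖y‖ ∧ ‖y‖ < 2 * L}, ‖V y‖ ^ 2 ≤
        K / L * ∫ y in {y | L / 4 ≤ ‖y‖ ∧ ‖y‖ ≤ 8 * L}, (‖V y‖ ^ 3 + 2 * (|P y| * ‖V y‖)) := by
  subst hγ
  obtain ⟨σ, hσ, hσc, hσ0, hσ1, hσone, hσzero, hσgrad⟩ := exists_radialBump
  obtain ⟨Kσ, hKσ0, hKσ⟩ := exists_norm_gradient_le hσ hσc
  -- the constant: `Kσ · 8^{3/2} · 2^{5/2}` (= 128 Kσ)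
  set A : ℝ := (8 : ℝ) ^ (3 / 2 : ℝ) * (2 : ℝ) ^ (5 / 2 : ℝ) with hA
  have hA0 : 0 < A := by positivity
  refine ⟨Kσ * A, by positivity, fun L hL => ?_⟩
  have hLEIσ := hLEI σ hσ hσc hσ0
  norm_num only at hLEIσ
  -- exponents are now `0`, `2/5`, `-(3/5)`: `(-τ)^0 = 1`
  simp only [Real.rpow_zero, one_mul] at hLEIσ
  -- the shell integrand `F = |V|³ + 2|P||V|` and the shells
  set F : EuclideanSpace ℝ (Fin 3) → ℝ := fun y => ‖V y‖ ^ 3 + 2 * (|P y| * ‖V y‖) with hF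
  set S : Set (EuclideanSpace ℝ (Fin 3)) := {y | L / 4 ≤ ‖y‖ ∧ ‖y‖ ≤ 8 * L} with hS
  have hF0 : ∀ y, 0 ≤ F y := fun y => by rw [hF]; positivity
  have hFeq : F = (fun y => ‖V y‖ ^ 3) + (2 : ℝ) • fun y => |P y| * ‖V y‖ := by
    funext y; simp only [hF, Pi.add_apply, Pi.smul_apply, smul_eq_mul]
  have hFloc : LocallyIntegrable F volume := by
    rw [hFeq]; exact hV3.add (hPV.smul (2 : ℝ))
  have hSmeas : MeasurableSet S :=
    (measurableSet_le measurable_const measurable_norm).inter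
      (measurableSet_le measurable_norm measurable_const)
  have hSbdd : S ⊆ closedBall (0 : EuclideanSpace ℝ (Fin 3)) (8 * L) := fun y hy => by
    rw [mem_closedBall, dist_zero_right]; exact hy.2
  have hFS : IntegrableOn F S volume :=
    (hFloc.integrableOn_isCompact (isCompact_closedBall _ _)).mono_set hSbdd
  set IF : ℝ := ∫ y in S, F y with hIF
  have hIF0 : 0 ≤ IF := setIntegral_nonneg hSmeas fun y _ => hF0 y
  -- the time windows `T₁ = (−(2/L)^{5/2}, −(1/L)^{5/2})`, `T₂ = (−(1/(4L))^{5/2}, −(1/(8L))^{5/2})`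
  set a₁ : ℝ := -((2 / L) ^ (5 / 2 : ℝ)) with ha₁
  set b₁ : ℝ := -((1 / L) ^ (5 / 2 : ℝ)) with hb₁
  set a₂ : ℝ := -((1 / (4 * L)) ^ (5 / 2 : ℝ)) with ha₂
  set b₂ : ℝ := -((1 / (8 * L)) ^ (5 / 2 : ℝ)) with hb₂
  have h52 : (0 : ℝ) < 5 / 2 := by norm_num
  have hab₁ : a₁ < b₁ := by
    rw [ha₁, hb₁, neg_lt_neg_iff]
    exact Real.rpow_lt_rpow (by positivity) (by rw [div_lt_div_iff_of_pos_right hL]; norm_num) h52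
  have hab₂ : a₂ < b₂ := by
    rw [ha₂, hb₂, neg_lt_neg_iff]
    exact Real.rpow_lt_rpow (by positivity)
      (one_div_lt_one_div_of_lt (by positivity) (by linarith)) h52
  have hb₁a₂ : b₁ < a₂ := by
    rw [hb₁, ha₂, neg_lt_neg_iff]
    exact Real.rpow_lt_rpow (by positivity)
      (one_div_lt_one_div_of_lt (by positivity) (by linarith)) h52
  have hb₂0 : b₂ < 0 := by rw [hb₂, neg_lt_zero]; positivity
  have hb₁0 : b₁ < 0 := by rw [hb₁, neg_lt_zero]; positivity
  -- a good `τ₁ ∈ T₁`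
  have hne₁ : (ae ((volume : Measure ℝ).restrict (Ioo a₁ b₁))).NeBot := by
    rw [ae_neBot, Ne, Measure.restrict_eq_zero, Real.volume_Ioo, ENNReal.ofReal_eq_zero, not_le]
    linarith
  obtain ⟨τ₁, hτ₁good, hτ₁mem⟩ :=
    ((ae_restrict_of_ae (hLEIσ) : ∀ᵐ τ₁ ∂(volume.restrict (Ioo a₁ b₁)), _).and
      (ae_restrict_mem measurableSet_Ioo)).exists
  have hτ₁0 : τ₁ < 0 := hτ₁mem.2.trans hb₁0
  have hτ₁' := hτ₁good hτ₁0
  -- a good `τ₂ ∈ T₂ ⊆ (τ₁, 0)`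
  have hne₂ : (ae ((volume : Measure ℝ).restrict (Ioo a₂ b₂))).NeBot := by
    rw [ae_neBot, Ne, Measure.restrict_eq_zero, Real.volume_Ioo, ENNReal.ofReal_eq_zero, not_le]
    linarith
  obtain ⟨τ₂, hτ₂good, hτ₂mem⟩ :=
    ((ae_restrict_of_ae hτ₁' : ∀ᵐ τ₂ ∂(volume.restrict (Ioo a₂ b₂)), _).and
      (ae_restrict_mem measurableSet_Ioo)).exists
  have hτ₂0 : τ₂ < 0 := hτ₂mem.2.trans hb₂0
  have hτ₁τ₂ : τ₁ < τ₂ := (hτ₁mem.2.trans hb₁a₂).trans hτ₂mem.1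
  have key := hτ₂good ⟨hτ₁τ₂, hτ₂0⟩
  -- the scales `s_i = (−τ_i)^{2/5}`: `1/L < s₁ < 2/L`, `1/(8L) < s₂ < 1/(4L)`
  set s₁ : ℝ := (-τ₁) ^ (2 / 5 : ℝ) with hs₁
  set s₂ : ℝ := (-τ₂) ^ (2 / 5 : ℝ) with hs₂
  have hnτ₁ : 0 < -τ₁ := neg_pos.2 hτ₁0
  have hnτ₂ : 0 < -τ₂ := neg_pos.2 hτ₂0
  have h25 : (0 : ℝ) < 2 / 5 := by norm_num
  have hpow : ∀ {c : ℝ}, 0 ≤ c → (c ^ (5 / 2 : ℝ)) ^ (2 / 5 : ℝ) = c := fun hc => by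
    rw [rpow_rpow_eq hc]; norm_num
  have hs₁lo : 1 / L < s₁ := by
    have h : (1 / L) ^ (5 / 2 : ℝ) < -τ₁ := by rw [hb₁] at hτ₁mem; linarith [hτ₁mem.2]
    have := Real.rpow_lt_rpow (by positivity) h h25
    rwa [hpow (by positivity)] at this
  have hs₁hi : s₁ < 2 / L := by
    have h : -τ₁ < (2 / L) ^ (5 / 2 : ℝ) := by rw [ha₁] at hτ₁mem; linarith [hτ₁mem.1]
    have := Real.rpow_lt_rpow hnτ₁.le h h25
    rwa [hpow (by positivity)] at this
  have hs₂lo : 1 / (8 * L) < s₂ := by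
    have h : (1 / (8 * L)) ^ (5 / 2 : ℝ) < -τ₂ := by rw [hb₂] at hτ₂mem; linarith [hτ₂mem.2]
    have := Real.rpow_lt_rpow (by positivity) h h25
    rwa [hpow (by positivity)] at this
  have hs₂hi : s₂ < 1 / (4 * L) := by
    have h : -τ₂ < (1 / (4 * L)) ^ (5 / 2 : ℝ) := by rw [ha₂] at hτ₂mem; linarith [hτ₂mem.1]
    have := Real.rpow_lt_rpow hnτ₂.le h h25
    rwa [hpow (by positivity)] at this
  have hs₁0 : 0 < s₁ := lt_trans (by positivity) hs₁lo
  have hs₂0 : 0 < s₂ := lt_trans (by positivity) hs₂lo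
  -- integrability of the energy integrands `|V|² σ(s • ·)`
  have hEint : ∀ {s : ℝ}, 0 < s → Integrable (fun y => ‖V y‖ ^ 2 * σ (s • y)) volume := by
    intro s hs
    have h := hV2.integrable_smul_left_of_hasCompactSupport
      (hσ.continuous.comp (continuous_const_smul s)) (hσc.comp_smul hs.ne')
    simpa [smul_eq_mul, mul_comm] using h
  -- (1) energy at `τ₂` from below: `σ(s₂ y) = 1` on `|y| ≤ 2L`
  have hV2cb : IntegrableOn (fun y => ‖V y‖ ^ 2) (closedBall (0 : EuclideanSpace ℝ (Fin 3)) (2 * L))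
      volume := hV2.integrableOn_isCompact (isCompact_closedBall _ _)
  have hE₂ : ∫ y in closedBall (0 : EuclideanSpace ℝ (Fin 3)) (2 * L), ‖V y‖ ^ 2 ≤
      ∫ y, ‖V y‖ ^ 2 * σ (s₂ • y) := by
    rw [← integral_indicator measurableSet_closedBall]
    refine integral_mono (hV2cb.integrable_indicator measurableSet_closedBall) (hEint hs₂0)
      fun y => ?_
    by_cases hy : y ∈ closedBall (0 : EuclideanSpace ℝ (Fin 3)) (2 * L)
    · rw [indicator_of_mem hy]
      have hy' : ‖s₂ • y‖ ≤ 1 / 2 := by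
        rw [mem_closedBall, dist_zero_right] at hy
        rw [norm_smul, Real.norm_eq_abs, abs_of_pos hs₂0]
        calc s₂ * ‖y‖ ≤ (1 / (4 * L)) * (2 * L) :=
              mul_le_mul hs₂hi.le hy (norm_nonneg _) (by positivity)
          _ = 1 / 2 := by field_simp; ring
      rw [hσone _ hy', mul_one]
    · rw [indicator_of_notMem hy]
      exact mul_nonneg (by positivity) (hσ0 _)
  -- (2) energy at `τ₁` from above: `σ(s₁ y) = 0` on `|y| ≥ L`
  have hV2b : IntegrableOn (fun y => ‖V y‖ ^ 2) (ball (0 : EuclideanSpace ℝ (Fin 3)) L) volume :=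
    (hV2.integrableOn_isCompact (isCompact_closedBall 0 L)).mono_set ball_subset_closedBall
  have hE₁ : ∫ y, ‖V y‖ ^ 2 * σ (s₁ • y) ≤ ∫ y in ball (0 : EuclideanSpace ℝ (Fin 3)) L, ‖V y‖ ^ 2 := by
    rw [← integral_indicator measurableSet_ball]
    refine integral_mono (hEint hs₁0) (hV2b.integrable_indicator measurableSet_ball) fun y => ?_
    by_cases hy : y ∈ ball (0 : EuclideanSpace ℝ (Fin 3)) L
    · rw [indicator_of_mem hy]
      exact mul_le_of_le_one_right (by positivity) (hσ1 _)
    · rw [indicator_of_notMem hy]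
      have hy' : 1 ≤ ‖s₁ • y‖ := by
        rw [mem_ball, dist_zero_right, not_lt] at hy
        rw [norm_smul, Real.norm_eq_abs, abs_of_pos hs₁0]
        calc (1 : ℝ) = (1 / L) * L := by field_simp
          _ ≤ s₁ * ‖y‖ := mul_le_mul hs₁lo.le hy hL.le hs₁0.le
      rw [hσzero _ hy', mul_zero]
  -- (3) the target shell sits inside `B̄_{2L} \ B_L`
  have hshell : ∫ y in {y | L ≤ ‖y‖ ∧ ‖y‖ < 2 * L}, ‖V y‖ ^ 2 ≤
      (∫ y in closedBall (0 : EuclideanSpace ℝ (Fin 3)) (2 * L), ‖V y‖ ^ 2) -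
        ∫ y in ball (0 : EuclideanSpace ℝ (Fin 3)) L, ‖V y‖ ^ 2 := by
    rw [← setIntegral_sdiff measurableSet_ball hV2cb
      (ball_subset_closedBall.trans (closedBall_subset_closedBall (by linarith)))]
    have hsub : {y : EuclideanSpace ℝ (Fin 3) | L ≤ ‖y‖ ∧ ‖y‖ < 2 * L} ⊆
        closedBall (0 : EuclideanSpace ℝ (Fin 3)) (2 * L) \ ball 0 L := fun y hy =>
      ⟨by rw [mem_closedBall, dist_zero_right]; exact hy.2.le,
        by rw [mem_ball, dist_zero_right, not_lt]; exact hy.1⟩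
    exact setIntegral_mono_set (hV2cb.mono_set sdiff_subset)
      (Eventually.of_forall fun y => by positivity) hsub.eventuallyLE
  -- (4) the flux: pointwise bound of the time integrand on `[τ₁, τ₂)`
  have hflux_pt : ∀ τ ∈ Ico τ₁ τ₂,
      ‖(-τ) ^ (-(3 / 5 : ℝ)) * ∫ y, (‖V y‖ ^ 2 + 2 * P y) * ⟪V y, gradient σ ((-τ) ^ (2 / 5 : ℝ) • y)⟫‖
        ≤ (-τ₂) ^ (-(3 / 5 : ℝ)) * (Kσ * IF) := by
    intro τ hτ
    have hτ0 : τ < 0 := hτ.2.trans hτ₂0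
    have hnτ : 0 < -τ := neg_pos.2 hτ0
    set s : ℝ := (-τ) ^ (2 / 5 : ℝ) with hs
    have hs0 : 0 < s := Real.rpow_pos_of_pos hnτ _
    -- `s₂ < s ≤ s₁`
    have hss₂ : s₂ < s := Real.rpow_lt_rpow hnτ₂.le (by linarith [hτ.2]) h25
    have hss₁ : s ≤ s₁ := Real.rpow_le_rpow hnτ.le (by linarith [hτ.1]) h25.le
    rw [norm_mul, Real.norm_eq_abs, abs_of_pos (Real.rpow_pos_of_pos hnτ _)]
    refine mul_le_mul ?_ ?_ (norm_nonneg _) (Real.rpow_pos_of_pos hnτ₂ _).le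
    · exact Real.rpow_le_rpow_of_nonpos hnτ₂ (by linarith [hτ.2]) (by norm_num)
    · -- `|∫ …| ≤ ∫_S Kσ F`
      have hdom : Integrable (S.indicator fun y => Kσ * F y) volume :=
        (hFS.integrable_indicator hSmeas).const_mul Kσ |>.congr (by
          refine Eventually.of_forall fun y => ?_
          by_cases hy : y ∈ S <;> simp [indicator, hy])
      rw [hIF, ← integral_const_mul, ← integral_indicator hSmeas]
      refine norm_integral_le_of_norm_le hdom (Eventually.of_forall fun y => ?_)
      by_cases hg : gradient σ (s • y) = 0
      · rw [hg, inner_zero_right, mul_zero, norm_zero]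
        by_cases hy : y ∈ S
        · rw [indicator_of_mem hy]; exact mul_nonneg hKσ0 (hF0 y)
        · rw [indicator_of_notMem hy]
      · -- `y ∈ S` since `1/2 ≤ s|y| ≤ 1`
        have hsy := hσgrad _ hg
        rw [norm_smul, Real.norm_eq_abs, abs_of_pos hs0] at hsy
        have hyS : y ∈ S := by
          refine ⟨?_, ?_⟩
          · -- `L/4 ≤ |y|` from `1/2 ≤ s|y|`, `s ≤ s₁ < 2/L`
            by_contra hlt
            rw [not_le] at hlt
            have : s * ‖y‖ < (2 / L) * (L / 4) :=
              mul_lt_mul' (hss₁.trans hs₁hi.le) hlt (norm_nonneg _) (by positivity)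
            have h2 : (2 / L) * (L / 4) = 1 / 2 := by field_simp; ring
            linarith [hsy.1]
          · -- `|y| ≤ 8L` from `s|y| ≤ 1`, `s > s₂ > 1/(8L)`
            by_contra hlt
            rw [not_le] at hlt
            have : (1 / (8 * L)) * (8 * L) < s * ‖y‖ :=
              mul_lt_mul'' (hs₂lo.trans hss₂) hlt (by positivity) (by positivity)
            have h2 : (1 / (8 * L)) * (8 * L) = 1 := by field_simp
            linarith [hsy.2]
        rw [indicator_of_mem hyS, Real.norm_eq_abs, abs_mul]
        calc |‖V y‖ ^ 2 + 2 * P y| * |⟪V y, gradient σ (s • y)⟫|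
            ≤ (‖V y‖ ^ 2 + 2 * |P y|) * (‖V y‖ * ‖gradient σ (s • y)‖) := by
              refine mul_le_mul ?_ (abs_real_inner_le_norm _ _) (abs_nonneg _) (by positivity)
              calc |‖V y‖ ^ 2 + 2 * P y| ≤ |‖V y‖ ^ 2| + |2 * P y| := abs_add_le _ _
                _ = ‖V y‖ ^ 2 + 2 * |P y| := by
                    rw [abs_of_nonneg (by positivity), abs_mul, abs_of_pos (by norm_num : (0:ℝ) < 2)]
          _ ≤ (‖V y‖ ^ 2 + 2 * |P y|) * (‖V y‖ * Kσ) := by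
              gcongr
              exact hKσ _
          _ = Kσ * F y := by rw [hF]; ring
  -- (5) the flux integral is at most `(τ₂ − τ₁) (−τ₂)^{−3/5} Kσ IF ≤ (Kσ A / L) IF`
  have hflux : ∫ τ in Ico τ₁ τ₂, (-τ) ^ (-(3 / 5 : ℝ)) *
      ∫ y, (‖V y‖ ^ 2 + 2 * P y) * ⟪V y, gradient σ ((-τ) ^ (2 / 5 : ℝ) • y)⟫ ≤
      Kσ * A / L * IF := by
    have h1 := norm_setIntegral_le_of_norm_le_const (μ := (volume : Measure ℝ))
      (s := Ico τ₁ τ₂) (by rw [Real.volume_Ico]; exact ENNReal.ofReal_lt_top) hflux_pt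
    rw [Measure.real, Real.volume_Ico, ENNReal.toReal_ofReal (by linarith)] at h1
    refine (le_abs_self _).trans ((Real.norm_eq_abs _ ▸ h1).trans ?_)
    -- `(−τ₂)^{−3/5} (τ₂ − τ₁) ≤ A / L`
    have hτ₂pow : (-τ₂) ^ (-(3 / 5 : ℝ)) ≤ (8 * L) ^ (3 / 2 : ℝ) := by
      have h : (1 / (8 * L)) ^ (5 / 2 : ℝ) ≤ -τ₂ := by rw [hb₂] at hτ₂mem; linarith [hτ₂mem.2]
      have h' := Real.rpow_le_rpow_of_nonpos (by positivity) h (by norm_num : -(3 / 5 : ℝ) ≤ 0)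
      refine h'.trans (le_of_eq ?_)
      rw [rpow_rpow_eq (by positivity), one_div, Real.inv_rpow (by positivity), ← Real.rpow_neg
        (by positivity)]
      norm_num
    have hτ₁pow : τ₂ - τ₁ ≤ (2 / L) ^ (5 / 2 : ℝ) := by
      rw [ha₁] at hτ₁mem; linarith [hτ₁mem.1, hτ₂0]
    have hAL : (8 * L) ^ (3 / 2 : ℝ) * (2 / L) ^ (5 / 2 : ℝ) = A / L := by
      rw [hA, Real.mul_rpow (by norm_num) hL.le, Real.div_rpow (by norm_num) hL.le]
      have hL32 : L ^ (3 / 2 : ℝ) / L ^ (5 / 2 : ℝ) = 1 / L := by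
        rw [← Real.rpow_sub hL, show (3 / 2 : ℝ) - 5 / 2 = -1 by norm_num, Real.rpow_neg_one,
          one_div]
      calc (8 : ℝ) ^ (3 / 2 : ℝ) * L ^ (3 / 2 : ℝ) * ((2 : ℝ) ^ (5 / 2 : ℝ) / L ^ (5 / 2 : ℝ))
          = (8 : ℝ) ^ (3 / 2 : ℝ) * (2 : ℝ) ^ (5 / 2 : ℝ) * (L ^ (3 / 2 : ℝ) / L ^ (5 / 2 : ℝ)) := by
            ring
        _ = (8 : ℝ) ^ (3 / 2 : ℝ) * (2 : ℝ) ^ (5 / 2 : ℝ) / L := by rw [hL32]; ring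
    calc (-τ₂) ^ (-(3 / 5 : ℝ)) * (Kσ * IF) * (τ₂ - τ₁)
        = ((-τ₂) ^ (-(3 / 5 : ℝ)) * (τ₂ - τ₁)) * (Kσ * IF) := by ring
      _ ≤ ((8 * L) ^ (3 / 2 : ℝ) * (2 / L) ^ (5 / 2 : ℝ)) * (Kσ * IF) := by
          refine mul_le_mul_of_nonneg_right ?_ (by positivity)
          exact mul_le_mul hτ₂pow hτ₁pow (by linarith) (by positivity)
      _ = Kσ * A / L * IF := by rw [hAL]; ring
  -- (6) assemble
  calc ∫ y in {y | L ≤ ‖y‖ ∧ ‖y‖ < 2 * L}, ‖V y‖ ^ 2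
      ≤ (∫ y in closedBall (0 : EuclideanSpace ℝ (Fin 3)) (2 * L), ‖V y‖ ^ 2) -
          ∫ y in ball (0 : EuclideanSpace ℝ (Fin 3)) L, ‖V y‖ ^ 2 := hshell
    _ ≤ (∫ y, ‖V y‖ ^ 2 * σ (s₂ • y)) - ∫ y, ‖V y‖ ^ 2 * σ (s₁ • y) := by linarith
    _ ≤ ∫ τ in Ico τ₁ τ₂, (-τ) ^ (-(3 / 5 : ℝ)) *
          ∫ y, (‖V y‖ ^ 2 + 2 * P y) * ⟪V y, gradient σ ((-τ) ^ (2 / 5 : ℝ) • y)⟫ := by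
        linarith [key]
    _ ≤ Kσ * A / L * IF := hflux

end Flux

end Summit.NavierStokesRegularity.NavierStokesRegularity.Theorems.PowerGaugeEulerLiouville
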